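import Summits.Ventures.CertifiedQuantumChemistry.Certificates.HubbardRingL4SectorDual
import HarnessLib

/-!
# Ventures/CertifiedQuantumChemistry — Certificates/HubbardRingL4SectorDualSound.lean: SOUNDNESS of the table-form dual certificate
# for the `(2,2)`-sector `DQG + ⟨Ŝ²⟩ = 0` programme of the Hubbard 4-ring (`Certificates/HubbardRingL4SectorDual.lean`, same seat / gen)

HONEST FRAMING (verbatim): certified bounds for a stated model Hamiltonian in a stated basis; not a
claim about the real molecule beyond that model. A CERTIFICATE FORMAT: no model value, no row, no claim node.

Seat rdm-B (gen 44); second half of the format (split for the 400-line lint). §5 writes every piece of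
`target − pairings − rows` on the raw moments `Re Γ_{P,R}`, `Re γ_{x,y}`, `1` (`pairQ_eq`, `pairG_eq`: the adjoints of Mazziotti's `qMap`
(14) / `gMap` (15); `nuRowsΓ_eq` / `nuRowsγ_eq`: the E2 rows; the traces, the exchange row, the doublon and bond sums as indicator sums),
so that `Σ defΓ·Re Γ`, `Σ defγ·Re γ`, `def0` ARE that difference (`sum_defΓ_eq`, `sum_defγ_eq`, `def0_eq`). §6 is weak duality:
**`DualL4.Dual.le_of_check`** — `d.check = true` and `zD, zQ, zG ⪰ 0` over `ℝ` give, at every `IsDQGFeasibleSinglet 2 γ Γ` (complex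
Hermitian data; rows from `IsDQGFeasibleSector` + `Rows/GMatrixRelaxationKernel.lean`'s E2 + Mazziotti's (98)),
`mu ≤ cd·Σ_p Re Γ_{(p↑p↓),(p↑p↓)} + ch·Σ_{p,σ} Re γ_{pσ,(p+1)σ}`. §7 spells it on the ring: **`Dual.mul_mu_le_pqgSingletEnergy`** —
with `cd = 1`, `ch = −2/U`, `U > 0`: `U·mu ≤ Model.pqgSingletEnergy (hubbardRingTV 4 1 U) 2` (gen 39's `Re E = −2·Σ bonds + U·Σ doublons`
and the Literature's `le_pqgSingletEnergy_iff`). 0 sorry, 0 def; standard axioms. References (docstring-only): E. Cancès, G. Stoltz,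
M. Lewin, J. Chem. Phys. 125 (2006) 064101 §3; M. Nakata et al., J. Chem. Phys. 128 (2008) 164113 §II.C–D; D. A. Mazziotti, Adv. Chem.
Phys. 134 (2007) ch. 3 §II.B, §II.F.
-/

set_option linter.style.longLine false

namespace Summit.Ventures.CertifiedQuantumChemistry

namespace DualL4

open Matrix Finset
open Literature.MathematicalPhysics.QuantumLattice Literature.MathematicalPhysics.QuantumChemistry
open Summit.Ventures.CertifiedQuantumChemistry.Hamiltonians
open scoped ComplexOrder

/-! ## §5 The pieces of the identity on raw moments -/

section Expansion

variable (d : Dual) (γ : Matrix O4 O4 ℂ) (Γ : Matrix OP OP ℂ)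

/-- The `Γ`-pairing written on raw moments. -/
theorem pairD_eq : ∑ I : OP, ∑ J : OP, ((d.zD I J : ℚ) : ℝ) * (Γ J I).re = ∑ P : OP, ∑ R : OP, ((d.zD R P : ℚ) : ℝ) * (Γ P R).re :=
  Finset.sum_comm

/-- `Re ([c]·w) = [c]·Re w` for an indicator factor. -/
theorem re_ite_one_mul (c : Prop) [Decidable c] (w : ℂ) : ((if c then (1 : ℂ) else 0) * w).re = if c then w.re else 0 := by
  by_cases h : c <;> simp [h]

/-- `Re ([a]·[b]) = [a ∧ b]`. -/
theorem re_ite_one_mul_ite (a b : Prop) [Decidable a] [Decidable b] :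
    ((if a then (1 : ℂ) else 0) * (if b then (1 : ℂ) else 0)).re = if a ∧ b then 1 else 0 := by
  by_cases ha : a <;> by_cases hb : b <;> simp [ha, hb]

/-- The real cast of `qConst`. -/
theorem qConst_cast (I J : OP) : ((Dual.qConst I J : ℚ) : ℝ) =
    (if J.1 = I.1 ∧ J.2 = I.2 then (1 : ℝ) else 0) - (if J.1 = I.2 ∧ J.2 = I.1 then (1 : ℝ) else 0) := by
  simp only [Dual.qConst, Rat.cast_sub, apply_ite (Rat.cast : ℚ → ℝ), Rat.cast_one, Rat.cast_zero]

/-- Real part of an entry of `qMap` (Mazziotti (14)), as a combination of raw moments. -/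
theorem qMap_re (I J : OP) : (qMap γ Γ J I).re =
    ((Dual.qConst I J : ℚ) : ℝ)
    - (if J.2 = I.2 then (γ I.1 J.1).re else 0) + (if J.2 = I.1 then (γ I.2 J.1).re else 0)
    + (if J.1 = I.2 then (γ I.1 J.2).re else 0) - (if J.1 = I.1 then (γ I.2 J.2).re else 0)
    + (Γ I J).re := by
  rw [qConst_cast]
  simp only [qMap, Complex.add_re, Complex.sub_re, re_ite_one_mul, apply_ite Complex.re, Complex.one_re,
    Complex.zero_re, ite_and]

/-- The `Q`-pairing on raw moments. -/
theorem pairQ_eq : ∑ I : OP, ∑ J : OP, ((d.zQ I J : ℚ) : ℝ) * (qMap γ Γ J I).re =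
    (∑ I : OP, ∑ J : OP, ((d.zQ I J : ℚ) : ℝ) * (Dual.qConst I J : ℝ))
    + ∑ x : O4, ∑ y : O4, (∑ m : O4, (- ((d.zQ (x, m) (y, m) : ℚ) : ℝ) + ((d.zQ (m, x) (y, m) : ℚ) : ℝ)
        + ((d.zQ (x, m) (m, y) : ℚ) : ℝ) - ((d.zQ (m, x) (m, y) : ℚ) : ℝ))) * (γ x y).re
    + ∑ P : OP, ∑ R : OP, ((d.zQ P R : ℚ) : ℝ) * (Γ P R).re := by
  simp only [qMap_re, mul_add, mul_sub, Finset.sum_add_distrib, Finset.sum_sub_distrib]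
  rw [collapseA' (fun I J => ((d.zQ I J : ℚ) : ℝ)) (fun x y => (γ x y).re),
    collapseB (fun I J => ((d.zQ I J : ℚ) : ℝ)) (fun x y => (γ x y).re),
    collapseC (fun I J => ((d.zQ I J : ℚ) : ℝ)) (fun x y => (γ x y).re),
    collapseD (fun I J => ((d.zQ I J : ℚ) : ℝ)) (fun x y => (γ x y).re)]
  simp only [Finset.sum_add_distrib, Finset.sum_sub_distrib, Finset.sum_neg_distrib, add_mul, sub_mul, neg_mul, Finset.sum_mul]
  ring

/-- The `G`-pairing on raw moments. -/
theorem pairG_eq : ∑ I : OP, ∑ J : OP, ((d.zG I J : ℚ) : ℝ) * (gMap γ Γ J I).re =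
    ∑ x : O4, ∑ y : O4, (∑ m : O4, ((d.zG (y, m) (x, m) : ℚ) : ℝ)) * (γ x y).re
      - ∑ P : OP, ∑ R : OP, ((d.zG (R.1, P.2) (P.1, R.2) : ℚ) : ℝ) * (Γ P R).re := by
  have split : ∀ I J : OP, ((d.zG I J : ℚ) : ℝ) * (gMap γ Γ J I).re =
      ((d.zG I J : ℚ) : ℝ) * (if J.2 = I.2 then (γ J.1 I.1).re else 0) - ((d.zG I J : ℚ) : ℝ) * (Γ (J.1, I.2) (I.1, J.2)).re := by
    intro I J
    simp only [gMap, Complex.sub_re, apply_ite Complex.re, Complex.zero_re, mul_sub]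
  simp only [split, Finset.sum_sub_distrib]
  rw [collapseA (fun I J => ((d.zG I J : ℚ) : ℝ)) (fun x y => (γ x y).re)]
  rw [sum_OP2_gSwap (fun I J => ((d.zG I J : ℚ) : ℝ) * (Γ (J.1, I.2) (I.1, J.2)).re)]

/-- The E2 rows' `Γ`-part on raw moments. -/
theorem nuRowsΓ_eq : ∑ P' : O4, ∑ k : O4, ∑ τ : Fin 2, ((d.nu P' k τ : ℚ) : ℝ) * ∑ y : Fin 4, (Γ (P', orb y τ) (k, orb y τ)).re =
    ∑ P : OP, ∑ R : OP, ((if P.2 = R.2 then d.nu P.1 R.1 (sp P.2) else 0 : ℚ) : ℝ) * (Γ P R).re := by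
  symm
  simp only [sum_OP]
  have hR : ∀ P1 P2 R1 : O4, ∑ R2 : O4, (((if P2 = R2 then d.nu P1 R1 (sp P2) else 0 : ℚ) : ℝ)) * (Γ (P1, P2) (R1, R2)).re =
      ((d.nu P1 R1 (sp P2) : ℚ) : ℝ) * (Γ (P1, P2) (R1, P2)).re := by
    intro P1 P2 R1
    simp only [apply_ite (Rat.cast : ℚ → ℝ), Rat.cast_zero, ite_mul, zero_mul, Finset.sum_ite_eq, Finset.mem_univ, if_true]
  simp only [hR]
  refine Finset.sum_congr rfl fun P1 _ => ?_
  -- Σ P2 Σ R1 G P2 R1 = Σ k Σ τ nu * Σ y ..  with P2 = orb y τ, R1 = k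
  simp only [Finset.mul_sum]
  rw [sum_orb4 (fun P2 => ∑ R1 : O4, ((d.nu P1 R1 (sp P2) : ℚ) : ℝ) * (Γ (P1, P2) (R1, P2)).re)]
  simp only [sp_orb]
  -- LHS: Σ y Σ τ Σ R1 ; RHS: Σ k Σ τ Σ y
  calc (∑ y : Fin 4, ∑ τ : Fin 2, ∑ R1 : O4, ((d.nu P1 R1 τ : ℚ) : ℝ) * (Γ (P1, orb y τ) (R1, orb y τ)).re)
      = ∑ y : Fin 4, ∑ R1 : O4, ∑ τ : Fin 2, ((d.nu P1 R1 τ : ℚ) : ℝ) * (Γ (P1, orb y τ) (R1, orb y τ)).re :=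
        Finset.sum_congr rfl fun _ _ => Finset.sum_comm
    _ = ∑ R1 : O4, ∑ y : Fin 4, ∑ τ : Fin 2, ((d.nu P1 R1 τ : ℚ) : ℝ) * (Γ (P1, orb y τ) (R1, orb y τ)).re := Finset.sum_comm
    _ = ∑ R1 : O4, ∑ τ : Fin 2, ∑ y : Fin 4, ((d.nu P1 R1 τ : ℚ) : ℝ) * (Γ (P1, orb y τ) (R1, orb y τ)).re :=
        Finset.sum_congr rfl fun _ _ => Finset.sum_comm

/-- The E2 rows' `γ`-part on raw moments. -/
theorem nuRowsγ_eq : ∑ P' : O4, ∑ k : O4, ∑ τ : Fin 2, ((d.nu P' k τ : ℚ) : ℝ) * ((2 - (if τ = sp k then 1 else 0)) * (γ P' k).re) =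
    ∑ x : O4, ∑ y : O4, ((∑ τ : Fin 2, (2 - (if τ = sp y then 1 else 0)) * d.nu x y τ : ℚ) : ℝ) * (γ x y).re := by
  refine Finset.sum_congr rfl fun x _ => Finset.sum_congr rfl fun y _ => ?_
  rw [Rat.cast_sum, Finset.sum_mul]
  refine Finset.sum_congr rfl fun τ _ => ?_
  simp only [Rat.cast_mul, Rat.cast_sub, Rat.cast_ofNat, apply_ite (Rat.cast : ℚ → ℝ), Rat.cast_one, Rat.cast_zero]
  ring

/-- Doublon diagonal as an indicator sum over ordered pairs. -/
theorem dbl_eq (a : ℝ) : ∑ P : OP, ∑ R : OP, (if P = R ∧ st P.1 = st P.2 ∧ sp P.1 = 0 ∧ sp P.2 = 1 then a else 0) * (Γ P R).re =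
    a * ∑ p : Fin 4, (Γ (orb p 0, orb p 1) (orb p 0, orb p 1)).re := by
  simp only [ite_and, ite_mul, zero_mul, Finset.sum_ite_eq, Finset.mem_univ, if_true, sum_OP, sum_orb4, st_orb, sp_orb,
    Fin.sum_univ_two, Fin.isValue, Finset.mul_sum]
  simp

/-- Like-spin block traces and the mixed block trace as indicator sums. -/
theorem trUU_eq (a : ℝ) : ∑ P : OP, ∑ R : OP, (if P = R ∧ sp P.1 = 0 ∧ sp P.2 = 0 then a else 0) * (Γ P R).re =
    a * ∑ x : Fin 4, ∑ y : Fin 4, (Γ (orb x 0, orb y 0) (orb x 0, orb y 0)).re := by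
  simp only [ite_and, ite_mul, zero_mul, Finset.sum_ite_eq, Finset.mem_univ, if_true, sum_OP, sum_orb4, sp_orb,
    Fin.sum_univ_two, Fin.isValue, Finset.mul_sum]
  simp

/-- `↓↓` block trace as an indicator sum. -/
theorem trDD_eq (a : ℝ) : ∑ P : OP, ∑ R : OP, (if P = R ∧ sp P.1 = 1 ∧ sp P.2 = 1 then a else 0) * (Γ P R).re =
    a * ∑ x : Fin 4, ∑ y : Fin 4, (Γ (orb x 1, orb y 1) (orb x 1, orb y 1)).re := by
  simp only [ite_and, ite_mul, zero_mul, Finset.sum_ite_eq, Finset.mem_univ, if_true, sum_OP, sum_orb4, sp_orb,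
    Fin.sum_univ_two, Fin.isValue, Finset.mul_sum]
  simp

/-- Mixed block trace as an indicator sum. -/
theorem trUD_eq (a : ℝ) : ∑ P : OP, ∑ R : OP, (if P = R ∧ sp P.1 = 0 ∧ sp P.2 = 1 then a else 0) * (Γ P R).re =
    a * ∑ x : Fin 4, ∑ y : Fin 4, (Γ (orb x 0, orb y 1) (orb x 0, orb y 1)).re := by
  simp only [ite_and, ite_mul, zero_mul, Finset.sum_ite_eq, Finset.mem_univ, if_true, sum_OP, sum_orb4, sp_orb,
    Fin.sum_univ_two, Fin.isValue, Finset.mul_sum]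
  simp

/-- The exchange (`S`-representability) row as an indicator sum. -/
theorem exch_eq (a : ℝ) : ∑ P : OP, ∑ R : OP,
    (if sp P.1 = 0 ∧ sp P.2 = 1 ∧ sp R.1 = 0 ∧ sp R.2 = 1 ∧ st R.1 = st P.2 ∧ st R.2 = st P.1 then a else 0) * (Γ P R).re =
    a * ∑ x : Fin 4, ∑ y : Fin 4, (Γ (orb x 0, orb y 1) (orb y 0, orb x 1)).re := by
  simp only [ite_mul, zero_mul, sum_OP, sum_orb4, Finset.mul_sum]
  dsimp only [st_orb, sp_orb]
  simp only [Fin.sum_univ_two, Fin.isValue, ite_and]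
  simp

/-- The bond sum as an indicator sum. -/
theorem bonds_eq (a : ℝ) : ∑ x : O4, ∑ y : O4, (if st y = finRotate 4 (st x) ∧ sp x = sp y then a else 0) * (γ x y).re =
    a * ∑ p : Fin 4, ∑ σ : Fin 2, (γ (orb p σ) (orb (finRotate 4 p) σ)).re := by
  simp only [ite_and, ite_mul, zero_mul, sum_orb4, sp_orb, st_orb, Finset.mul_sum, Fin.sum_univ_two, Fin.isValue]
  simp [mul_add]

/-- One-matrix traces as indicator sums. -/
theorem trOne_eq (a : ℝ) : ∑ x : O4, ∑ y : O4, (if x = y then a else 0) * (γ x y).re = a * ∑ i : O4, (γ i i).re := by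
  simp only [ite_mul, zero_mul, Finset.sum_ite_eq, Finset.mem_univ, if_true, Finset.mul_sum]

/-- `Tr γ_↑` as an indicator sum. -/
theorem trUp_eq (a : ℝ) : ∑ x : O4, ∑ y : O4, (if x = y ∧ sp x = 0 then a else 0) * (γ x y).re =
    a * ∑ p : Fin 4, (γ (orb p 0) (orb p 0)).re := by
  simp only [ite_and, ite_mul, zero_mul, Finset.sum_ite_eq, if_true, sum_orb4, sp_orb, Fin.sum_univ_two,
    Fin.isValue, Finset.mul_sum]
  simp

/-- `Tr γ_↓` as an indicator sum. -/
theorem trDn_eq (a : ℝ) : ∑ x : O4, ∑ y : O4, (if x = y ∧ sp x = 1 then a else 0) * (γ x y).re =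
    a * ∑ p : Fin 4, (γ (orb p 1) (orb p 1)).re := by
  simp only [ite_and, ite_mul, zero_mul, Finset.sum_ite_eq, if_true, sum_orb4, sp_orb, Fin.sum_univ_two,
    Fin.isValue, Finset.mul_sum]
  simp

/-- The `Γ`-defect table evaluated: target pieces minus pairing pieces minus row pieces. -/
theorem sum_defΓ_eq : ∑ P : OP, ∑ R : OP, ((d.defΓ P R : ℚ) : ℝ) * (Γ P R).re =
    (d.cd : ℝ) * ∑ p : Fin 4, (Γ (orb p 0, orb p 1) (orb p 0, orb p 1)).re
    - ∑ P : OP, ∑ R : OP, ((d.zD R P : ℚ) : ℝ) * (Γ P R).re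
    - ∑ P : OP, ∑ R : OP, ((d.zQ P R : ℚ) : ℝ) * (Γ P R).re
    + ∑ P : OP, ∑ R : OP, ((d.zG (R.1, P.2) (P.1, R.2) : ℚ) : ℝ) * (Γ P R).re
    - ∑ P : OP, ∑ R : OP, ((if P.2 = R.2 then d.nu P.1 R.1 (sp P.2) else 0 : ℚ) : ℝ) * (Γ P R).re
    - (d.tUU : ℝ) * ∑ x : Fin 4, ∑ y : Fin 4, (Γ (orb x 0, orb y 0) (orb x 0, orb y 0)).re
    - (d.tDD : ℝ) * ∑ x : Fin 4, ∑ y : Fin 4, (Γ (orb x 1, orb y 1) (orb x 1, orb y 1)).re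
    - (d.tUD : ℝ) * ∑ x : Fin 4, ∑ y : Fin 4, (Γ (orb x 0, orb y 1) (orb x 0, orb y 1)).re
    - (d.xi : ℝ) * ∑ x : Fin 4, ∑ y : Fin 4, (Γ (orb x 0, orb y 1) (orb y 0, orb x 1)).re := by
  rw [← dbl_eq Γ, ← trUU_eq Γ, ← trDD_eq Γ, ← trUD_eq Γ, ← exch_eq Γ]
  simp only [Dual.defΓ, Rat.cast_sub, Rat.cast_add, apply_ite (Rat.cast : ℚ → ℝ), Rat.cast_zero, sub_mul, add_mul,
    Finset.sum_sub_distrib, Finset.sum_add_distrib]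

/-- The `γ`-defect table evaluated. -/
theorem sum_defγ_eq : ∑ x : O4, ∑ y : O4, ((d.defγ x y : ℚ) : ℝ) * (γ x y).re =
    (d.ch : ℝ) * ∑ p : Fin 4, ∑ σ : Fin 2, (γ (orb p σ) (orb (finRotate 4 p) σ)).re
    - ∑ x : O4, ∑ y : O4, (∑ m : O4, (- ((d.zQ (x, m) (y, m) : ℚ) : ℝ) + ((d.zQ (m, x) (y, m) : ℚ) : ℝ)
        + ((d.zQ (x, m) (m, y) : ℚ) : ℝ) - ((d.zQ (m, x) (m, y) : ℚ) : ℝ))) * (γ x y).re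
    - ∑ x : O4, ∑ y : O4, (∑ m : O4, ((d.zG (y, m) (x, m) : ℚ) : ℝ)) * (γ x y).re
    + ∑ x : O4, ∑ y : O4, ((∑ τ : Fin 2, (2 - (if τ = sp y then 1 else 0)) * d.nu x y τ : ℚ) : ℝ) * (γ x y).re
    - (d.tOne : ℝ) * ∑ i : O4, (γ i i).re
    - (d.tUp : ℝ) * ∑ p : Fin 4, (γ (orb p 0) (orb p 0)).re
    - (d.tDn : ℝ) * ∑ p : Fin 4, (γ (orb p 1) (orb p 1)).re := by
  rw [← bonds_eq γ, ← trOne_eq γ, ← trUp_eq γ, ← trDn_eq γ]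
  simp only [Dual.defγ, Rat.cast_sub, Rat.cast_add, Rat.cast_neg, Rat.cast_sum, apply_ite (Rat.cast : ℚ → ℝ), Rat.cast_zero,
    sub_mul, add_mul, Finset.sum_sub_distrib, Finset.sum_add_distrib]

/-- The constant defect evaluated. -/
theorem def0_eq : ((d.def0 : ℚ) : ℝ) = - (d.mu : ℝ) - ∑ I : OP, ∑ J : OP, ((d.zQ I J : ℚ) : ℝ) * ((Dual.qConst I J : ℚ) : ℝ)
    + 4 * d.tOne + 2 * d.tUp + 2 * d.tDn + 2 * d.tUU + 2 * d.tDD + 4 * d.tUD + 2 * d.xi := by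
  simp only [Dual.def0]; push_cast; ring

end Expansion

/-! ## §6 SOUNDNESS: `check` + three PSD tables ⇒ `mu ≤ cd·Σ doublons + ch·Σ bonds` on the singlet-feasible set -/

section Sound

open Literature.MathematicalPhysics.QuantumChemistry

/-- The E2 rows at `(a, b) = (2, 2)`: `Σ_y Γ_{(P, yτ),(k, yτ)} = (2 − [τ = spin k])·γ_{P,k}` (real parts), from
`Rows/GMatrixRelaxationKernel.lean`. -/
theorem e2_row {γ : Matrix O4 O4 ℂ} {Γ : Matrix OP OP ℂ} (h : IsDQGFeasibleSector 2 2 γ Γ) (P k : O4) (τ : Fin 2) :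
    (∑ y : Fin 4, (Γ (P, orb y τ) (k, orb y τ)).re) = (2 - (if τ = sp k then 1 else 0)) * (γ P k).re := by
  have hab : (2 : ℕ) + 2 ≠ 0 := by norm_num
  obtain ⟨q, σ, rfl⟩ : ∃ q σ, k = orb q σ := ⟨st k, sp k, (orb_st_sp k).symm⟩
  rw [← Complex.re_sum, sp_orb]
  have h00 := congrArg Complex.re (sum_two_upUp_of_isDQGFeasibleSector h hab P q)
  have h10 := congrArg Complex.re (sum_two_upDown_of_isDQGFeasibleSector h hab P q)
  have h11 := congrArg Complex.re (sum_two_downDown_of_isDQGFeasibleSector h hab P q)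
  have h01 := congrArg Complex.re (sum_two_downUp_of_isDQGFeasibleSector h hab P q)
  fin_cases τ <;> fin_cases σ <;> simp only [Fin.isValue, Fin.mk_one, Fin.zero_eta] at h00 h10 h11 h01 ⊢
  · rw [h00]; simp only [Complex.mul_re, Complex.sub_re, Complex.natCast_re, Complex.one_re, Complex.sub_im,
      Complex.natCast_im, Complex.one_im]; norm_num
  · rw [h01]; simp only [Complex.mul_re, Complex.natCast_re, Complex.natCast_im]; norm_num
  · rw [h10]; simp only [Complex.mul_re, Complex.natCast_re, Complex.natCast_im]; norm_num
  · rw [h11]; simp only [Complex.mul_re, Complex.sub_re, Complex.natCast_re, Complex.one_re, Complex.sub_im,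
      Complex.natCast_im, Complex.one_im]; norm_num

/-- **SOUNDNESS OF THE TABLE-FORM DUAL CERTIFICATE.** If the canonical defect tables vanish (`check`, decidable) and the three dual
tables are positive semidefinite over `ℝ`, then for every singlet-feasible pair `(γ, Γ)` of the `(2,2)` sector of the 4-ring
`mu ≤ cd·Σ_p Re Γ_{(p↑p↓),(p↑p↓)} + ch·Σ_{p,σ} Re γ_{pσ,(p+1)σ}` — weak duality (Cancès–Stoltz–Lewin (8)–(10); Nakata et al. §II.D). -/
theorem Dual.le_of_check (d : Dual) (hc : d.check = true) (hD : (Dual.realZ d.zD).PosSemidef) (hQ : (Dual.realZ d.zQ).PosSemidef)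
    (hG : (Dual.realZ d.zG).PosSemidef) {γ : Matrix O4 O4 ℂ} {Γ : Matrix OP OP ℂ} (hf : IsDQGFeasibleSinglet 2 γ Γ) :
    (d.mu : ℝ) ≤ (d.cd : ℝ) * ∑ p : Fin 4, (Γ (orb p 0, orb p 1) (orb p 0, orb p 1)).re
      + (d.ch : ℝ) * ∑ p : Fin 4, ∑ σ : Fin 2, (γ (orb p σ) (orb (finRotate 4 p) σ)).re := by
  have hs : IsDQGFeasibleSector 2 2 γ Γ := hf.toIsDQGFeasibleSector
  have hq : IsDQGFeasible (2 + 2) γ Γ := hs.dqg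
  -- pairings ≥ 0
  have pD := pairing_nonneg hD hq.d_psd
  have pQ := pairing_nonneg hQ hq.q_psd
  have pG := pairing_nonneg hG hq.g_psd
  rw [pairD_eq] at pD
  rw [pairQ_eq] at pQ
  rw [pairG_eq] at pG
  -- rows
  have rNu : ∑ P' : O4, ∑ k : O4, ∑ τ : Fin 2, ((d.nu P' k τ : ℚ) : ℝ) * ∑ y : Fin 4, (Γ (P', orb y τ) (k, orb y τ)).re =
      ∑ P' : O4, ∑ k : O4, ∑ τ : Fin 2, ((d.nu P' k τ : ℚ) : ℝ) * ((2 - (if τ = sp k then 1 else 0)) * (γ P' k).re) := by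
    refine Finset.sum_congr rfl fun P' _ => Finset.sum_congr rfl fun k _ => Finset.sum_congr rfl fun τ _ => ?_
    rw [e2_row hs]
  rw [nuRowsΓ_eq, nuRowsγ_eq] at rNu
  have rOne : ∑ i : O4, (γ i i).re = 4 := by
    have h := congrArg Complex.re hq.trace_one; rw [Complex.re_sum] at h; simpa using h
  have rUp : ∑ p : Fin 4, (γ (orb p 0) (orb p 0)).re = 2 := by
    have h := congrArg Complex.re hs.trace_up; rw [Complex.re_sum] at h; simpa using h
  have rDn : ∑ p : Fin 4, (γ (orb p 1) (orb p 1)).re = 2 := by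
    have h := congrArg Complex.re hs.trace_down; rw [Complex.re_sum] at h; simpa using h
  have rUU : ∑ x : Fin 4, ∑ y : Fin 4, (Γ (orb x 0, orb y 0) (orb x 0, orb y 0)).re = 2 := by
    have h := congrArg Complex.re hs.trace_upUp; simp only [Complex.re_sum] at h; push_cast at h; norm_num at h; exact h
  have rDD : ∑ x : Fin 4, ∑ y : Fin 4, (Γ (orb x 1, orb y 1) (orb x 1, orb y 1)).re = 2 := by
    have h := congrArg Complex.re hs.trace_downDown; simp only [Complex.re_sum] at h; push_cast at h; norm_num at h; exact h
  have rUD : ∑ x : Fin 4, ∑ y : Fin 4, (Γ (orb x 0, orb y 1) (orb x 0, orb y 1)).re = 4 := by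
    have h := congrArg Complex.re hs.trace_upDown; simp only [Complex.re_sum] at h; push_cast at h; norm_num at h; exact h
  have rEx : ∑ x : Fin 4, ∑ y : Fin 4, (Γ (orb x 0, orb y 1) (orb y 0, orb x 1)).re = 2 := by
    have h := congrArg Complex.re hf.exchange_sum; simp only [Complex.re_sum] at h; push_cast at h; simpa using h
  -- the identity: canonical defects vanish
  obtain ⟨hcΓ, hcγ, hc0⟩ := d.check_spec hc
  have zΓ : ∑ P : OP, ∑ R : OP, ((d.defΓ P R : ℚ) : ℝ) * (Γ P R).re = 0 := by
    rw [sum_defΓ_canon d hq.d_psd.1 hq.swap_fst hq.swap_snd]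
    have : ∀ P R : OP, d.cdefΓ P R = 0 := by
      rintro ⟨x, y⟩ ⟨u, v⟩
      rw [← orb_st_sp x, ← orb_st_sp y, ← orb_st_sp u, ← orb_st_sp v]
      exact hcΓ _ _ _ _ _ _ _ _
    simp [this]
  have zγ : ∑ x : O4, ∑ y : O4, ((d.defγ x y : ℚ) : ℝ) * (γ x y).re = 0 := by
    rw [sum_defγ_canon d hq.herm_one hs.spin_sel]
    have : ∀ x y : O4, d.cdefγ x y = 0 := by
      intro x y
      rw [← orb_st_sp x, ← orb_st_sp y]
      exact hcγ _ _ _ _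
    simp [this]
  have z0 : ((d.def0 : ℚ) : ℝ) = 0 := by rw [hc0]; push_cast; ring
  rw [sum_defΓ_eq, rUU, rDD, rUD, rEx] at zΓ
  rw [sum_defγ_eq, rOne, rUp, rDn] at zγ
  rw [def0_eq] at z0
  -- assemble: target − mu = Σ pairings (≥ 0) + Σ rows (= 0)
  linarith [pD, pQ, pG, rNu, zΓ, zγ, z0]

end Sound

/-! ## §7 The bound spelt on `hubbardRingTV 4 1 U`: `U·mu ≤ E_PQG(N = 4, ⟨Ŝ²⟩ = 0)` when `cd = 1`, `ch = −2/U` -/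

section Ring

/-- **THE CERTIFIED LOWER BOUND ON THE SINGLET-RESTRICTED DQG VALUE OF THE 4-RING.** For a checked certificate with positive
semidefinite tables whose target is the ring energy divided by `U` (`cd = 1`, `ch = −2/U`, `U > 0`; gen 39's
`Re E = −2·Σ bonds + U·Σ doublons`): `U·mu ≤ Model.pqgSingletEnergy (hubbardRingTV 4 1 U) 2`. -/
theorem Dual.mul_mu_le_pqgSingletEnergy (d : Dual) (hc : d.check = true) (hD : (Dual.realZ d.zD).PosSemidef)
    (hQ : (Dual.realZ d.zQ).PosSemidef) (hG : (Dual.realZ d.zG).PosSemidef) {U : ℚ} (hU : 0 < U) (hcd : d.cd = 1)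
    (hch : d.ch = -2 / U) :
    (U : ℝ) * (d.mu : ℝ) ≤ Model.pqgSingletEnergy (hubbardRingTV 4 1 U) 2 := by
  rw [Model.pqgSingletEnergy, le_pqgSingletEnergy_iff _ _ _ (by simp)]
  intro γ Γ hf
  have h := d.le_of_check hc hD hQ hG hf
  rw [RingEnergy.hubbardRingTV_re_rdmEnergy_eq_of_feasible (by norm_num) 1 U hf.toIsDQGFeasibleSector]
  rw [hcd, hch] at h
  push_cast at h
  have hU' : (0 : ℝ) < U := by exact_mod_cast hU
  have hUne : (U : ℝ) ≠ 0 := hU'.ne'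
  -- U·mu ≤ U·(Σ doublons − (2/U)·Σ bonds) = −2·Σ bonds + U·Σ doublons
  have key : (U : ℝ) * (d.mu : ℝ) ≤ (U : ℝ) * (1 * ∑ p : Fin 4, (Γ (orb p 0, orb p 1) (orb p 0, orb p 1)).re
      + -2 / (U : ℝ) * ∑ p : Fin 4, ∑ σ : Fin 2, (γ (orb p σ) (orb (finRotate 4 p) σ)).re) :=
    mul_le_mul_of_nonneg_left h hU'.le
  have e : (U : ℝ) * (1 * ∑ p : Fin 4, (Γ (orb p 0, orb p 1) (orb p 0, orb p 1)).re
      + -2 / (U : ℝ) * ∑ p : Fin 4, ∑ σ : Fin 2, (γ (orb p σ) (orb (finRotate 4 p) σ)).re) =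
      -2 * ((1 : ℚ) : ℝ) * ∑ p : Fin 4, ∑ σ : Fin 2, (γ (orb p σ) (orb (finRotate 4 p) σ)).re
      + (U : ℝ) * ∑ p : Fin 4, (Γ (orb p 0, orb p 1) (orb p 0, orb p 1)).re := by
    push_cast; field_simp; ring
  rw [← e]
  exact key

end Ring



end DualL4

end Summit.Ventures.CertifiedQuantumChemistry
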